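import Literature.NumberTheory.LFunctions.WeilExplicit
import Literature.NumberTheory.LFunctions.WeilExplicitProofs
import Literature.NumberTheory.LFunctions.RHConditionalFacts
import Literature.NumberTheory.LFunctions.WeilCriterionConverse
import Literature.NumberTheory.LFunctions.WeilExplicitFormulaProofs
import HarnessLib

/-!
# Weil's criterion `RH ↔ WeilPositivity`: reduction to the explicit formula and the zero-side converse

Proof file (D-0014) for the named fact `Literature.weil_criterion : RiemannHypothesis ↔ WeilPositivity`
(`Literature/NumberTheory/LFunctions/RHConditionalFacts.lean`, [Bombieri2000, Thm. 2]). All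
objects (`IsWeilTest`, `weilMellin g s = ĝ(s) = ∫ g(t) e^{(s-1/2)t} dt`, `weilReflect g = g̃`,
`weilConv`, `weilFunctional = W`, `weilZeroSidePartial`, `HasWeilZeroSide`, `weilQuadratic`,
`WeilPositivity`, the named fact `explicit_formula`) are those of
`Literature/NumberTheory/LFunctions/WeilExplicit.lean` (additive variable `t = log x`,
normalisation symmetric at `1/2`); the easy half `WeilPositivity.of_riemannHypothesis
(hEF : explicit_formula) : RiemannHypothesis → WeilPositivity` is
`Literature/NumberTheory/LFunctions/WeilExplicitProofs.lean`.

## The printed proof (E. Bombieri, Rend. Mat. Acc. Lincei (9) 11 (2000), §§2–3) and its tree image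

* §2, EXPLICIT FORMULA: for `f ∈ C₀^∞((0, ∞))`, `∑_ρ f̃(ρ) = T[f]` (prime-side functional), the
  zeros summed symmetrically. Tree: the named fact `explicit_formula`
  (`IsWeilTest g → HasWeilZeroSide g (weilFunctional g)`), NOT proved.
* §3, first display: for `f = g * ḡ*`, `f̃(s) = g̃(s) · \overline{g̃}(1 - s)`; additively
  `(g ⋆ g̃)^(s) = ĝ(s) conj ĝ(1 - conj s)`. Tree: `weilMellin_weilQuadratic` (proved,
  `WeilExplicitProofs`).
* §3, THEOREM 1 ("RH iff `∑_ρ g̃(ρ) \overline{g̃}(1-ρ) > 0` for every `g ∈ C₀^∞((0,∞))`,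
  `g ≢ 0`"), "only if" half, eq. (3.2): under RH `1 - ρ = ρ̄` and the sum is `∑ |g̃(ρ)|² ≥ 0`.
  Tree: `WeilPositivity.of_riemannHypothesis` (proved modulo `explicit_formula`,
  `WeilExplicitProofs`).
* §3, THEOREM 1, "if" half (pp. 189–190: Li's criterion (3.3) after Bombieri–Lagarias, the
  inverse Mellin transform `g_n` of `1 - (1 - 1/s)^n`, its truncations `g_{n,ε}` and the limit
  (3.4) via the de la Vallée-Poussin zero-free region, then smoothing by a compactly supported
  approximate identity): if RH fails there is a smooth compactly supported `g` with
  `∑_ρ g̃(ρ) \overline{g̃}(1-ρ) < 0`. Tree: the NAMED FACT `weil_criterion_zeroSide_converse`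
  below (a statement about the zeros of `ζ` and Mellin transforms of test functions only — no
  prime side), NOT proved here.
* §3, THEOREM 2 ("By the Explicit Formula and Theorem 1 we have THEOREM 2": `T[f] = ∑_ρ f̃(ρ)`,
  and "the Riemann Hypothesis is equivalent to the statement that `T[f * f̄*] ≥ 0` on
  `C₀^∞((0, ∞))`"; Abstract: "positive semidefinite if and only if the Riemann Hypothesis is
  true"). Tree: `weil_criterion`; here `weil_criterion_of (hEF : explicit_formula)
  (hC : weil_criterion_zeroSide_converse) : weil_criterion` isolates exactly the two unproved
  inputs. `weil_criterion_holds` is to be appended to this file once both are discharged.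

## Contents

* `weil_criterion_zeroSide_converse` (NAMED FACT, [Bombieri2000, Thm. 1, "if" half]).
* `riemannHypothesis_of_weilPositivity (hEF) (hC) : WeilPositivity → RiemannHypothesis`.
* `weil_criterion_of (hEF) (hC) : weil_criterion`.

## References

* E. Bombieri, *Remarks on Weil's quadratic functional in the theory of prime numbers I*, Atti
  Accad. Naz. Lincei Cl. Sci. Fis. Mat. Natur. Rend. Lincei (9) Mat. Appl. 11 (2000), no. 3,
  183–233, §2 (Explicit Formula), §3 Thm. 1, Thm. 2 (Zbl 1008.11034).
* A. Weil, *Sur les "formules explicites" de la théorie des nombres premiers*, Comm. Sém. Math.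
  Univ. Lund, Tome suppl. (1952), 252–265.
* E. Bombieri, J. C. Lagarias, *Complements to Li's criterion for the Riemann Hypothesis*,
  J. Number Theory 77 (1999), 274–287.
-/

noncomputable section

open Complex Filter Set MeasureTheory
open scoped Real Topology

namespace Literature.NumberTheory.LFunctions

/-! ## Bombieri 2000, Theorem 1, "if" half (named fact) -/

/-- **rh.S29** NAMED FACT (the converse half of Weil's criterion in ZERO-SIDE form; E. Bombieri,
*Remarks on Weil's quadratic functional in the theory of prime numbers I*, Rend. Mat. Acc.
Lincei (9) 11 (2000), 183–233, §3, Theorem 1: "The Riemann Hypothesis holds if and only if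
`∑_ρ g̃(ρ) \overline{g̃}(1 - ρ) > 0` for every complex-valued `g(x) ∈ C₀^∞((0, ∞))`, not
identically `0`", the sum over the non-trivial zeros being the symmetric one of the Explicit
Formula of §2, with multiplicity; originally A. Weil, Comm. Sém. Math. Univ. Lund (1952)). What is
recorded is the "if" half in the form the printed proof (pp. 189–190: Li's criterion (3.3), the
truncations `g_{n,ε}`, the limit (3.4), smoothing) actually establishes and the Abstract states
("positive semidefinite if and only if the Riemann Hypothesis is true"): if RH fails there is a
smooth compactly supported `g` whose symmetric zero sum `∑_ρ g̃(ρ) \overline{g̃}(1 - ρ)`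
converges to a number with negative real part. Contrapositively, in the additive variable of
`WeilExplicit` (where `(g ⋆ g̃)^(ρ) = ĝ(ρ) conj ĝ(1 - conj ρ)`, `weilMellin_weilQuadratic`): if
for every smooth compactly supported `g : ℝ → ℂ` every limit `Z` of the symmetric partial sums
`∑_{ζ(ρ)=0, 0 ≤ Re ρ ≤ 1, 0 < |Im ρ| ≤ T} m(ρ) (g ⋆ g̃)^(ρ)` (`HasWeilZeroSide (g ⋆ g̃) Z`)
satisfies `Re Z ≥ 0`, then the Riemann hypothesis holds. No prime side enters; together with
`explicit_formula` this yields `weil_criterion` (`weil_criterion_of`). Users take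
`(h : weil_criterion_zeroSide_converse)`. [cite: Bombieri2000, Thm. 1 ("if" half; proof pp. 189–190)] -/
def weil_criterion_zeroSide_converse : Prop :=
  (∀ g : ℝ → ℂ, IsWeilTest g →
      ∀ Z : ℂ, HasWeilZeroSide (weilConv g (weilReflect g)) Z → 0 ≤ Z.re) →
    RiemannHypothesis

/-! ## Assembly of `weil_criterion` (Bombieri 2000, Theorem 2) -/

/-- **Weil positivity ⇒ RH**, given the explicit formula and the zero-side converse
([Bombieri2000, Thm. 2 = Explicit Formula + Thm. 1]): by `explicit_formula` the symmetric zero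
sum of `g ⋆ g̃` converges to `W(g ⋆ g̃) = weilQuadratic g`, whose real part is `≥ 0` by
`WeilPositivity`; limits along `atTop : Filter ℝ` are unique, so the hypothesis of
`weil_criterion_zeroSide_converse` is met. [cite: Bombieri2000, Thm. 2] -/
theorem riemannHypothesis_of_weilPositivity (hEF : explicit_formula)
    (hC : weil_criterion_zeroSide_converse) (hW : WeilPositivity) : RiemannHypothesis :=
  hC fun g hg Z hZ ↦ by
    have h : Z = weilQuadratic g := tendsto_nhds_unique hZ (hEF (hg.weilConv hg.weilReflect))
    rw [h]
    exact hW g hg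

/-- **Assembly of Weil's criterion** ([Bombieri2000, Thm. 2]: "By the Explicit Formula and
Theorem 1 we have THEOREM 2 … the Riemann Hypothesis is equivalent to the statement that
`T[f * f̄*] ≥ 0` on `C₀^∞((0, ∞))`"): `weil_criterion` (`RiemannHypothesis ↔ WeilPositivity`)
follows from the named facts `explicit_formula` (`WeilExplicit`) and
`weil_criterion_zeroSide_converse`; the forward half is `WeilPositivity.of_riemannHypothesis`
(`WeilExplicitProofs`). `weil_criterion_holds` will be this theorem once both inputs are
discharged. [cite: Bombieri2000, Thm. 2] -/
theorem weil_criterion_of (hEF : explicit_formula) (hC : weil_criterion_zeroSide_converse) :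
    weil_criterion :=
  ⟨WeilPositivity.of_riemannHypothesis hEF, riemannHypothesis_of_weilPositivity hEF hC⟩

/-! ## Discharges (appended): both inputs of `weil_criterion_of` are now theorems

* `explicit_formula_holds : explicit_formula` — the Guinand–Weil explicit formula for `ζ`
  (Bombieri 2000, §2), `Literature/NumberTheory/LFunctions/WeilExplicitFormulaProofs.lean`
  (weighted argument principle for `ξ` and `ĝ` on `[-1/2, 3/2] × [-T, T]`, good heights, edge
  limits; right edge = `2π W(g)` in `WeilExplicitRightEdge.lean`).
* `WeilConverse.riemannHypothesis_of_zeroSide_nonneg` — Bombieri 2000, Theorem 1, "if" half in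
  the zero-side semidefinite form (exactly the body of `weil_criterion_zeroSide_converse`),
  `Literature/NumberTheory/LFunctions/WeilCriterionConverse.lean` (translation/polarisation of the
  zero-side form, a bounded generalised Dirichlet series over the zeros, Laplace transform and
  identity theorem — a route needing neither Li's criterion nor a zero-free region).

Hence `weil_criterion_zeroSide_converse_holds`, `weil_criterion_of_explicit_formula` and the
DISCHARGE `weil_criterion_holds : weil_criterion` of the named fact `Literature.NumberTheory.LFunctions.weil_criterion`
(`RHConditionalFacts.lean`), Bombieri's Theorem 2 (= Explicit Formula + Theorem 1).
-/

/-- **Discharge of `weil_criterion_zeroSide_converse`** (Bombieri 2000, Thm. 1, "if" half, in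
the semidefinite zero-side form recorded by the named fact): if every limit of the symmetric zero
sums of `g ⋆ g̃` has non-negative real part for every test `g`, then the Riemann hypothesis holds
— `WeilConverse.riemannHypothesis_of_zeroSide_nonneg` (`WeilCriterionConverse.lean`).
[cite: Bombieri2000Weil, Thm. 1 ("if" half; proof pp. 189–190)] -/
theorem weil_criterion_zeroSide_converse_holds : weil_criterion_zeroSide_converse :=
  fun H ↦ WeilConverse.riemannHypothesis_of_zeroSide_nonneg H

/-- **Weil's criterion from the explicit formula alone**: with the zero-side converse discharged,
`weil_criterion` (`RiemannHypothesis ↔ WeilPositivity`, [Bombieri2000Weil, Thm. 2]) follows from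
the explicit formula `explicit_formula` (`WeilExplicit.lean`). [cite: Bombieri2000Weil, Thm. 2] -/
theorem weil_criterion_of_explicit_formula (hEF : explicit_formula) : weil_criterion :=
  weil_criterion_of hEF weil_criterion_zeroSide_converse_holds

/-- **DISCHARGE of the named fact `Literature.NumberTheory.LFunctions.weil_criterion`** (E. Bombieri, *Remarks on Weil's
quadratic functional in the theory of prime numbers I*, Rend. Mat. Acc. Lincei (9) 11 (2000),
183–233, **Theorem 2**: "The Riemann Hypothesis is equivalent to the statement that
`T[f * f̄*] ≥ 0` for every complex-valued `f ∈ C₀^∞((0, ∞))`"; Abstract: "positive semidefinite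
if and only if the Riemann Hypothesis is true"; originally A. Weil 1952):
`RiemannHypothesis ↔ WeilPositivity`, from the explicit formula (`explicit_formula_holds`,
`WeilExplicitFormulaProofs.lean`, Bombieri §2) and the two halves of Bombieri's Theorem 1
(`WeilPositivity.of_riemannHypothesis`, `WeilExplicitProofs.lean`;
`weil_criterion_zeroSide_converse_holds`). [cite: Bombieri2000Weil, Thm. 2] -/
theorem weil_criterion_holds : weil_criterion :=
  weil_criterion_of_explicit_formula explicit_formula_holds

end Literature.NumberTheory.LFunctions

end
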